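import Summits.ResolutionOfSingularities.ResolutionOfSingularities.Theses.PAlteration
import Literature.AlgebraicGeometry.Resolution.RegularLocalRingsNormal

/-!
# `Pialt` — negative lemmas III: the finite strengthening (no blow-up) is false — the node

Support (negative) lemmas for crux `stmt-ResolutionOfSingularities-0555`
(`Summit.ResolutionOfSingularities.ResolutionOfSingularities.Theses.PAlteration.Pialt`: for every
prime `p`, every integral separated finite-type `X / k` with `char k = p` has a proper surjective
`g : X' → X` from an integral regular `X'`, finite and universally injective over a dense open of
`X` — a purely inseparable regular alteration; Abramovich–Oort 2000 Q. 2.13 = Temkin 2013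
Conj. 1.3.1, positive-characteristic slice), filed by the standing disprover (cdisprove gen 1; work
file `Cruxes/Pialt/Disproof.lean`). This file declares NO definition: every variant statement is
written out inline, and NO declaration concludes the route decl `Pialt` positively.

* `isNilpotent_of_appTop_eq_zero`, `isUnit_of_isUnit_appTop` — pull-back of global sections along
  a SURJECTIVE morphism `X' → Spec R` reflects `0` (up to nilpotents) and units.
* `node_eval_zero_eq_eval_one` — elements of the node algebra `k[T² − T, T³ − T²] ⊆ k[T]` take
  the same value at `0` and `1`.
* `not_pialtFinite_at` / `not_pialtFinite` — the natural strengthening of the crux "finite +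
  universally injective over ALL of `X`" (a finite radicial surjective cover by an integral regular
  scheme, no blow-up) is FALSE at every prime: for the node `X = Spec 𝔽_p[T² − T, T³ − T²]`
  (affine line with `0 ∼ 1`), a finite radicial surjective `g : X' → X` with `X'` integral regular
  makes `X' = Spec B` affine with `B` a normal domain finite over the node algebra `A` (regular
  local rings are integrally closed — Matsumura 19.4, in tree — and normality is local), so
  `T = (T³ − T²)/(T² − T)` lies in `B`; `T ↦ τ` gives an injective `χ : k[T] → B` extending
  `A → B` with `B` integral over `k[T]`, and lying over produces primes of `B` over `(T)` and over
  `(T − 1)` — distinct, with the same contraction to `A` — i.e. two points of `X'` over the node,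
  contradicting injectivity. So the `∃ U dense` relaxation in the crux is necessary: at
  non-(geometrically-)unibranch points the purely inseparable regular alteration must blow up.

## Sources
* H. Matsumura, *Commutative Ring Theory*, CUP 1986, Thm. 19.4 (regular local ⇒ normal; in tree
  as `isIntegrallyClosed_of_isRegularLocalRing`).
* The Stacks Project, Tag 00FZ (lying over), Tag 0BQ3 (geometrically unibranch; the node is the
  standard non-example), Tag 02IS (regular schemes).
-/

noncomputable section

-- single-problem summit: the doubled namespace component `ResolutionOfSingularities` is forced
set_option linter.dupNamespace false

open CategoryTheory AlgebraicGeometry TopologicalSpace Topology Polynomial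
open Literature.AlgebraicGeometry.Resolution

namespace Summit.ResolutionOfSingularities.ResolutionOfSingularities.Theorems.Pialt.Negative

/-! ### Helpers: sections pulled back along a surjective morphism to an affine scheme -/

/-- If `g : X' → Spec R` is surjective and the pull-back of `r ∈ R` vanishes on `X'`, then `r` is
nilpotent (`D(r)` has empty preimage, hence is empty). [folklore] -/
theorem isNilpotent_of_appTop_eq_zero {R : Type} [CommRing R] {X' : Scheme.{0}}
    (g : X' ⟶ Spec (.of R)) (hsurj : Function.Surjective g.base) (r : R)
    (h : g.appTop ((Scheme.ΓSpecIso (.of R)).inv r) = 0) : IsNilpotent r := by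
  have hpre : g ⁻¹ᵁ (Spec (.of R)).basicOpen ((Scheme.ΓSpecIso (.of R)).inv r) = ⊥ := by
    rw [Scheme.preimage_basicOpen_top, h, Scheme.basicOpen_zero]
  have hD' : (Spec (.of R)).basicOpen ((Scheme.ΓSpecIso (.of R)).inv r) = ⊥ := by
    ext z
    simp only [TopologicalSpace.Opens.coe_bot, Set.mem_empty_iff_false, iff_false]
    intro hz
    obtain ⟨w, hw⟩ := hsurj z
    have hw' : w ∈ g ⁻¹ᵁ (Spec (.of R)).basicOpen ((Scheme.ΓSpecIso (.of R)).inv r) := by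
      show g.base w ∈ ((Spec (.of R)).basicOpen _ : Set _)
      rw [hw]; exact hz
    rw [hpre] at hw'
    exact hw'
  rw [basicOpen_eq_of_affine] at hD'
  exact (PrimeSpectrum.basicOpen_eq_bot_iff _).mp hD'

/-- If `g : X' → Spec R` is surjective and the pull-back of `r ∈ R` is a unit on `X'`, then `r`
is a unit (`D(r)` has full preimage, hence is everything). [folklore] -/
theorem isUnit_of_isUnit_appTop {R : Type} [CommRing R] {X' : Scheme.{0}}
    (g : X' ⟶ Spec (.of R)) (hsurj : Function.Surjective g.base) (r : R)
    (h : IsUnit (g.appTop ((Scheme.ΓSpecIso (.of R)).inv r))) : IsUnit r := by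
  by_contra hr
  obtain ⟨M, hM, hrM⟩ := exists_max_ideal_of_mem_nonunits hr
  let y : ↥(Spec (.of R)) := (⟨M, hM.isPrime⟩ : PrimeSpectrum R)
  obtain ⟨x, hx⟩ := hsurj y
  have hxmem : x ∈ X'.basicOpen (g.appTop ((Scheme.ΓSpecIso (.of R)).inv r)) :=
    (Scheme.mem_basicOpen_top _ _ _).mpr (h.map _)
  rw [← Scheme.preimage_basicOpen_top] at hxmem
  have h2 : g.base x ∈ (Spec (.of R)).basicOpen ((Scheme.ΓSpecIso (.of R)).inv r) := hxmem
  rw [hx, basicOpen_eq_of_affine] at h2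
  exact (PrimeSpectrum.mem_basicOpen _ _).mp h2 hrM

/-! ### The node `k[T² − T, T³ − T²]` -/

/-- Elements of the node algebra `k[T² − T, T³ − T²] ⊆ k[T]` take the same value at `0` and at
`1` (the node is the affine line with `0` and `1` glued). [folklore] -/
theorem node_eval_zero_eq_eval_one {k : Type} [Field k] (a : k[X])
    (ha : a ∈ Algebra.adjoin k ({X ^ 2 - X, X ^ 3 - X ^ 2} : Set k[X])) :
    a.eval 0 = a.eval 1 := by
  induction ha using Algebra.adjoin_induction with
  | mem x hx =>
    simp only [Set.mem_insert_iff, Set.mem_singleton_iff] at hx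
    rcases hx with rfl | rfl <;> simp
  | algebraMap r => simp
  | add x y _ _ hx hy => simp [hx, hy]
  | mul x y _ _ hx hy => simp [hx, hy]

/-- **The finite strengthening of the crux is false**, at every prime `p`: it is NOT true that
every integral separated finite-type `X / k` (`char k = p`) admits a FINITE, universally injective,
surjective morphism from an integral regular scheme (i.e. that the purely inseparable regular
alteration can be taken finite over all of `X`, with no blow-up). Witness: the node
`X = Spec k[T² − T, T³ − T²]` (`k = 𝔽_p`; the affine line with `0 ∼ 1`). If `g : X' → X` is
finite, radicial and surjective with `X'` integral and regular, then `X' = Spec B` is affine, `B`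
is a normal domain finite over `A = k[T² − T, T³ − T²]` (regular local rings are integrally
closed, Matsumura 19.4, and normality is local), so `T = (T³ − T²)/(T² − T)` — integral over `A` —
lies in `B`: there is `τ ∈ B` with `τ² − τ = u`, `τ u = v` (`u, v` the two generators). The
substitution `T ↦ τ` gives `χ : k[T] → B` extending `A → B`; `B` is finite over `k[T]`, and `χ` is
injective (else `k[T]/ker χ` is a field inside `B` in which `u = τ² − τ ≠ 0` becomes a unit, while
`u` is not a unit on `X`, and pull-back along the surjective `g` reflects units). Lying over gives
primes `Q₀ ∋ τ` over `(T)` and `Q₁ ∋ τ − 1` over `(T − 1)` of `B`, distinct, but with the same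
contraction to `A` (an element of `A` vanishes at `0` iff it vanishes at `1`): two points of `X'`
over the node, contradicting injectivity. So at non-(geometrically-)unibranch points the
alteration of the crux must genuinely blow up. [folklore] -/
theorem not_pialtFinite_at (p : ℕ) [Fact p.Prime] :
    ¬ ∀ (k : Type) [Field k] [CharP k p] (X : Scheme.{0}) (f : X ⟶ Spec (.of k)),
      IsSeparated f → LocallyOfFiniteType f → QuasiCompact f → IsIntegral X →
        ∃ (X' : Scheme.{0}) (g : X' ⟶ X), IsIntegral X' ∧ Scheme.IsRegular X' ∧
          IsFinite g ∧ UniversallyInjective g ∧ Function.Surjective g.base := by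
  intro h
  -- the node over `𝔽_p`
  let A : Subalgebra (ZMod p) (ZMod p)[X] :=
    Algebra.adjoin (ZMod p) ({X ^ 2 - X, X ^ 3 - X ^ 2} : Set (ZMod p)[X])
  haveI : Algebra.FiniteType (ZMod p) ↥A := by
    refine ⟨(Subalgebra.fg_top A).mpr ⟨{X ^ 2 - X, X ^ 3 - X ^ 2}, ?_⟩⟩
    simp [A]
  let f : Spec (.of ↥A) ⟶ Spec (.of (ZMod p)) :=
    Spec.map (CommRingCat.ofHom (algebraMap (ZMod p) ↥A))
  haveI : LocallyOfFiniteType f :=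
    (HasRingHomProperty.Spec_iff (P := @LocallyOfFiniteType)).mpr
      (RingHom.finiteType_algebraMap.mpr inferInstance)
  obtain ⟨X', g, hint, hreg, hfin, hui, hsurj⟩ :=
    h (ZMod p) (Spec (.of ↥A)) f inferInstance inferInstance inferInstance inferInstance
  -- `X'` is affine and `B = Γ(X', ⊤)` is finite over `A`
  haveI : IsAffine X' := isAffine_of_isAffineHom g
  obtain ⟨-, hfinT⟩ := (HasAffineProperty.iff_of_isAffine (P := @IsFinite)).mp hfin
  let ι : CommRingCat.of ↥A ⟶ Γ(Spec (.of ↥A), ⊤) := (Scheme.ΓSpecIso (.of ↥A)).inv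
  let ψ : ↥A →+* ↑Γ(X', ⊤) := g.appTop.hom.comp ι.hom
  have hψfin : ψ.Finite :=
    hfinT.comp (RingHom.Finite.of_surjective ι.hom
      (Scheme.ΓSpecIso (.of ↥A)).commRingCatIsoToRingEquiv.symm.surjective)
  -- the generators `u = T² - T`, `v = T³ - T² = T u`, with `v² = u³ + u v`
  have hu_mem : (X ^ 2 - X : (ZMod p)[X]) ∈ A := Algebra.subset_adjoin (by simp)
  have hv_mem : (X ^ 3 - X ^ 2 : (ZMod p)[X]) ∈ A := Algebra.subset_adjoin (by simp)
  let u : ↥A := ⟨X ^ 2 - X, hu_mem⟩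
  let v : ↥A := ⟨X ^ 3 - X ^ 2, hv_mem⟩
  have huv : v ^ 2 = u ^ 3 + u * v := by
    apply Subtype.ext
    simp only [u, v, SubmonoidClass.mk_pow, Subalgebra.coe_add, Subalgebra.coe_mul]
    ring
  have hu_natDegree : (X ^ 2 - X : (ZMod p)[X]).natDegree = 2 := by
    rw [Polynomial.natDegree_sub_eq_left_of_natDegree_lt] <;> simp
  have hu0 : u ≠ 0 := by
    intro h0
    have h1 : (X ^ 2 - X : (ZMod p)[X]) = 0 := congrArg Subtype.val h0
    have h2 := congrArg Polynomial.natDegree h1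
    rw [hu_natDegree, Polynomial.natDegree_zero] at h2
    exact absurd h2 (by norm_num)
  -- `ψ u ≠ 0` and `ψ u` is not a unit (pull-back along the surjective `g` reflects both)
  have hψu0 : ψ u ≠ 0 := fun h0 =>
    hu0 (isNilpotent_of_appTop_eq_zero g hsurj u h0).eq_zero
  have hψu_nu : ¬ IsUnit (ψ u) := fun hunit => by
    have h1 : IsUnit u := isUnit_of_isUnit_appTop g hsurj u hunit
    have h2 : IsUnit (u : (ZMod p)[X]) := h1.map A.val
    have h3 := Polynomial.natDegree_eq_zero_of_isUnit h2
    have h4 : (u : (ZMod p)[X]).natDegree = 2 := hu_natDegree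
    omega
  -- `B` is an integrally closed domain (regular local rings are normal; normality is local)
  have hIC : IsIntegrallyClosed ↑Γ(X', ⊤) := by
    refine IsIntegrallyClosed.of_localization_maximal fun P _ hP => ?_
    let q : ↥(Spec Γ(X', ⊤)) := (⟨P, hP.isPrime⟩ : PrimeSpectrum ↑Γ(X', ⊤))
    have h1 : IsRegularLocalRing ↑(X'.presheaf.stalk (X'.isoSpec.inv.base q)) := hreg _
    haveI h2 : IsRegularLocalRing ↑((Spec Γ(X', ⊤)).presheaf.stalk q) :=
      IsRegularLocalRing.of_ringEquiv (asIso (X'.isoSpec.inv.stalkMap q)).commRingCatIsoToRingEquiv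
    haveI : IsRegularLocalRing (Localization.AtPrime P) :=
      IsRegularLocalRing.of_ringEquiv (Spec.stalkIso Γ(X', ⊤) q).commRingCatIsoToRingEquiv
    exact isIntegrallyClosed_of_isRegularLocalRing _
  -- `τ ∈ B` with `τ ψ(u) = ψ(v)` and `τ² - τ = ψ(u)`: the image of `T`
  obtain ⟨τ, hτu, hτ2⟩ : ∃ τ : ↑Γ(X', ⊤), τ * ψ u = ψ v ∧ τ ^ 2 - τ = ψ u := by
    let K := FractionRing ↑Γ(X', ⊤)
    have hKu : algebraMap ↑Γ(X', ⊤) K (ψ u) ≠ 0 := fun h0 =>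
      hψu0 (IsFractionRing.injective ↑Γ(X', ⊤) K (h0.trans (map_zero _).symm))
    set θ : K := algebraMap _ K (ψ v) / algebraMap _ K (ψ u) with hθdef
    have hrel : (ψ v) ^ 2 = (ψ u) ^ 3 + ψ u * ψ v := by
      rw [← map_pow, huv, map_add, map_pow, map_mul]
    have hrelK : (algebraMap _ K (ψ v)) ^ 2 =
        (algebraMap _ K (ψ u)) ^ 3 + algebraMap _ K (ψ u) * algebraMap _ K (ψ v) := by
      have := congrArg (algebraMap ↑Γ(X', ⊤) K) hrel
      simpa only [map_pow, map_add, map_mul] using this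
    have hθb : θ * algebraMap _ K (ψ u) = algebraMap _ K (ψ v) := div_mul_cancel₀ _ hKu
    have hθ : θ ^ 2 - θ - algebraMap _ K (ψ u) = 0 := by
      have key : (θ ^ 2 - θ - algebraMap _ K (ψ u)) * (algebraMap _ K (ψ u)) ^ 2 = 0 := by
        linear_combination
          (θ * algebraMap _ K (ψ u) + algebraMap _ K (ψ v) - algebraMap _ K (ψ u)) * hθb + hrelK
      rcases mul_eq_zero.mp key with h1 | h1
      · exact h1
      · exact absurd ((pow_eq_zero_iff two_ne_zero).mp h1) hKu
    have hmonic : (X ^ 2 - X - C (ψ u) : (↑Γ(X', ⊤))[X]).Monic := by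
      rw [sub_sub]
      apply (Polynomial.monic_X_pow 2).sub_of_left
      refine (Polynomial.degree_add_le _ _).trans_lt ?_
      rw [Polynomial.degree_X_pow, Polynomial.degree_X, Polynomial.degree_C hψu0]
      decide
    have hθint : IsIntegral ↑Γ(X', ⊤) θ := by
      refine ⟨X ^ 2 - X - C (ψ u), hmonic, ?_⟩
      simp only [Polynomial.eval₂_sub, Polynomial.eval₂_X_pow, Polynomial.eval₂_X,
        Polynomial.eval₂_C]
      exact hθ
    obtain ⟨τ, hτ⟩ := (isIntegrallyClosed_iff K).mp hIC hθint
    refine ⟨τ, ?_, ?_⟩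
    · apply IsFractionRing.injective ↑Γ(X', ⊤) K
      rw [map_mul, hτ, hθb]
    · apply IsFractionRing.injective ↑Γ(X', ⊤) K
      rw [map_sub, map_pow, hτ]
      linear_combination hθ
  -- `χ : k[T] → B`, `T ↦ τ`, extends `ψ`
  let χ : (ZMod p)[X] →+* ↑Γ(X', ⊤) :=
    Polynomial.eval₂RingHom (ψ.comp (algebraMap (ZMod p) ↥A)) τ
  have hχX : χ X = τ := Polynomial.eval₂_X _ _
  have hχC : ∀ r, χ (C r) = ψ (algebraMap (ZMod p) ↥A r) := fun r => Polynomial.eval₂_C _ _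
  have hχu : χ (X ^ 2 - X) = ψ u := by
    rw [map_sub, map_pow, hχX, hτ2]
  have hχv : χ (X ^ 3 - X ^ 2) = ψ v := by
    have : χ (X ^ 3 - X ^ 2) = τ * (τ ^ 2 - τ) := by rw [map_sub, map_pow, map_pow, hχX]; ring
    rw [this, hτ2, hτu]
  have hagree : ∀ (a : (ZMod p)[X]) (ha : a ∈ A), χ a = ψ ⟨a, ha⟩ := by
    intro a ha
    induction ha using Algebra.adjoin_induction with
    | mem x hx =>
      simp only [Set.mem_insert_iff, Set.mem_singleton_iff] at hx
      rcases hx with rfl | rfl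
      · exact hχu
      · exact hχv
    | algebraMap r => exact hχC r
    | add x y hx hy ihx ihy =>
      rw [map_add, ihx, ihy, ← map_add]; rfl
    | mul x y hx hy ihx ihy =>
      rw [map_mul, ihx, ihy, ← map_mul]; rfl
  have hagree' : ∀ a : ↥A, χ (a : (ZMod p)[X]) = ψ a := fun a => hagree a.1 a.2
  -- `B` is integral over `k[T]` via `χ` (it is finite, hence integral, over `A` via `ψ`)
  letI algχ : Algebra (ZMod p)[X] ↑Γ(X', ⊤) := χ.toAlgebra
  have hψint : ψ.IsIntegral := hψfin.to_isIntegral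
  have hcompval : (algebraMap (ZMod p)[X] ↑Γ(X', ⊤)).comp (algebraMap ↥A (ZMod p)[X]) = ψ :=
    RingHom.ext fun a => hagree' a
  haveI : Algebra.IsIntegral (ZMod p)[X] ↑Γ(X', ⊤) := ⟨fun b => by
    obtain ⟨P, hPm, hPb⟩ := hψint b
    refine ⟨P.map (algebraMap ↥A (ZMod p)[X]), hPm.map _, ?_⟩
    rw [Polynomial.eval₂_map, hcompval]
    exact hPb⟩
  -- `χ` is injective
  have hχinj : RingHom.ker χ = ⊥ := by
    by_contra hne
    haveI hprime : (RingHom.ker χ).IsPrime := RingHom.ker_isPrime χ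
    haveI hmax : (RingHom.ker χ).IsMaximal := IsPrime.to_maximal_ideal hne
    have hcls : Ideal.Quotient.mk (RingHom.ker χ) (X ^ 2 - X) ≠ 0 := by
      rw [Ne, Ideal.Quotient.eq_zero_iff_mem, RingHom.mem_ker, hχu]
      exact hψu0
    letI := Ideal.Quotient.field (RingHom.ker χ)
    have hunit : IsUnit (Ideal.Quotient.mk (RingHom.ker χ) (X ^ 2 - X)) :=
      isUnit_iff_ne_zero.mpr hcls
    have h1 := hunit.map (Ideal.Quotient.lift (RingHom.ker χ) χ fun a ha => ha)
    rw [Ideal.Quotient.lift_mk, hχu] at h1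
    exact hψu_nu h1
  -- two primes of `B`, over `(T)` and over `(T - 1)`
  have hcomap_bot : Ideal.comap (algebraMap (ZMod p)[X] ↑Γ(X', ⊤)) ⊥ = ⊥ := by
    show Ideal.comap χ ⊥ = ⊥
    rw [← RingHom.ker_eq_comap_bot, hχinj]
  let 𝔭₀ : Ideal (ZMod p)[X] := Ideal.span {X}
  let 𝔭₁ : Ideal (ZMod p)[X] := Ideal.span {X - C 1}
  haveI : 𝔭₀.IsPrime :=
    (Ideal.span_singleton_prime Polynomial.X_ne_zero).mpr Polynomial.prime_X
  haveI : 𝔭₁.IsPrime :=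
    (Ideal.span_singleton_prime (Polynomial.X_sub_C_ne_zero 1)).mpr (Polynomial.prime_X_sub_C 1)
  obtain ⟨Q₀, -, hQ₀, hQ₀c⟩ := Ideal.exists_ideal_over_prime_of_isIntegral 𝔭₀
    (⊥ : Ideal ↑Γ(X', ⊤)) (by rw [hcomap_bot]; exact bot_le)
  obtain ⟨Q₁, -, hQ₁, hQ₁c⟩ := Ideal.exists_ideal_over_prime_of_isIntegral 𝔭₁
    (⊥ : Ideal ↑Γ(X', ⊤)) (by rw [hcomap_bot]; exact bot_le)
  have hQne : Q₀ ≠ Q₁ := by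
    intro heq
    have h1 : 𝔭₀ = 𝔭₁ := by rw [← hQ₀c, ← hQ₁c, heq]
    have hX1 : (X : (ZMod p)[X]) ∈ 𝔭₁ := h1 ▸ Ideal.mem_span_singleton_self X
    rw [Ideal.mem_span_singleton, Polynomial.dvd_iff_isRoot] at hX1
    simp at hX1
  -- ... with the same contraction to `A`
  have hsame : Q₀.comap ψ = Q₁.comap ψ := by
    ext a
    rw [Ideal.mem_comap, Ideal.mem_comap, ← hagree' a]
    have e0 : χ (a : (ZMod p)[X]) ∈ Q₀ ↔ (a : (ZMod p)[X]) ∈ 𝔭₀ := by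
      rw [← hQ₀c, Ideal.mem_comap]; rfl
    have e1 : χ (a : (ZMod p)[X]) ∈ Q₁ ↔ (a : (ZMod p)[X]) ∈ 𝔭₁ := by
      rw [← hQ₁c, Ideal.mem_comap]; rfl
    rw [e0, e1, Ideal.mem_span_singleton, Ideal.mem_span_singleton, Polynomial.X_dvd_iff,
      Polynomial.dvd_iff_isRoot, Polynomial.IsRoot.def, Polynomial.coeff_zero_eq_eval_zero,
      node_eval_zero_eq_eval_one _ a.2]
  -- the corresponding two points of `X'` have the same image under `g`: contradiction
  haveI := hui
  let q₀ : ↥(Spec Γ(X', ⊤)) := (⟨Q₀, hQ₀⟩ : PrimeSpectrum _)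
  let q₁ : ↥(Spec Γ(X', ⊤)) := (⟨Q₁, hQ₁⟩ : PrimeSpectrum _)
  have hnat : X'.isoSpec.inv ≫ g = Spec.map (ι ≫ g.appTop) := by
    rw [← Scheme.isoSpec_inv_naturality g, Scheme.isoSpec_Spec_inv, ← Spec.map_comp]
  have hg : ∀ q : ↥(Spec Γ(X', ⊤)),
      g.base (X'.isoSpec.inv.base q) = PrimeSpectrum.comap ψ q := by
    intro q
    have h1 := congrArg (fun φ : Spec Γ(X', ⊤) ⟶ Spec (.of ↥A) => φ.base q) hnat
    exact h1
  have heq : q₀ = q₁ := by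
    apply (Scheme.homeoOfIso X'.isoSpec.symm).injective
    apply g.injective
    show g.base (X'.isoSpec.inv.base q₀) = g.base (X'.isoSpec.inv.base q₁)
    rw [hg, hg]
    exact PrimeSpectrum.ext hsame
  exact hQne (congrArg (fun q : PrimeSpectrum ↑Γ(X', ⊤) => q.asIdeal) heq)


/-- **The finite strengthening of the crux is false** (all primes quantified, the crux's own
shape with "finite + universally injective over a dense open `U`" replaced by "finite +
universally injective over all of `X`"). [folklore] -/
theorem not_pialtFinite :
    ¬ ∀ p : ℕ, p.Prime → ∀ (k : Type) [Field k] [CharP k p] (X : Scheme.{0})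
      (f : X ⟶ Spec (.of k)), IsSeparated f → LocallyOfFiniteType f → QuasiCompact f →
        IsIntegral X → ∃ (X' : Scheme.{0}) (g : X' ⟶ X), IsIntegral X' ∧ Scheme.IsRegular X' ∧
          IsFinite g ∧ UniversallyInjective g ∧ Function.Surjective g.base :=
  fun h => not_pialtFinite_at 2 (fun k _ _ X f hs hl hq hi => h 2 Nat.prime_two k X f hs hl hq hi)

end Summit.ResolutionOfSingularities.ResolutionOfSingularities.Theorems.Pialt.Negative

end
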